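import Mathlib
import HarnessLib

/-!
# Line `taylor-model` on crux K1b-DR (`ExactWindowRungThree.DerivativeEnclosureCertificateR`,
# stmt-NavierStokesRegularity-23954) — VECTOR STEP LEMMA, part 13: the ROW-WISE MEAN-VALUE MATRIX (input of the
# Lohner transport, PROPAGATE-V-SPEC-cert1 §2 C/E: `φ(z)(h) − φ(z′)(h) ∈ [M_s]·(z − z′)`)

For a map `f : (ι → ℝ) → (ι → ℝ)` Fréchet-differentiable WITHIN a convex set `S` whose derivative columns are
enclosed entrywise, `Mlo c' c ≤ f' x e_c c' ≤ Mhi c' c` on `S`, and two points `z, z' ∈ S`, there is a REAL MATRIX `A`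
inside the interval matrix `[Mlo, Mhi]` with `f z − f z' = A · (z − z')` exactly — one mean-value point per ROW
(`exists_hasDerivAt_eq_slope` on `σ ↦ f (z' + σ • (z − z')) c'`).  No integration, no norm.

* `clm_apply_eq_sum_single` — `L v c' = Σ_c v c · L e_c c'` for a continuous linear map on `ι → ℝ`;
* `exists_matrix_mem_Icc_of_hasFDerivWithin` — the statement above;
* `exists_rowPoints_of_hasFDerivWithin` — the point form (one mean-value point of the segment per row), for in-step
  transports where the column bounds depend on the point (Taylor models in `u`).

MODEL-lattice bookkeeping only (rung TL-M3 of the NS ladder: one finite-dimensional model ODE); nothing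
here is a statement about the Navier–Stokes equations.
-/

noncomputable section

-- the sub-problem namespace repeats the summit name by design (D-0017)
set_option linter.dupNamespace false

namespace Summit.NavierStokesRegularity.NavierStokesRegularity.Theorems.TaylorModelVector

open scoped BigOperators Topology
open Set Filter

variable {ι : Type*} [Fintype ι] [DecidableEq ι]

/-- A continuous linear map on `ι → ℝ` in coordinates: `L v c' = Σ_c v c · L e_c c'`. [folklore] -/
theorem clm_apply_eq_sum_single (L : (ι → ℝ) →L[ℝ] (ι → ℝ)) (v : ι → ℝ) (c' : ι) :
    L v c' = ∑ c, v c * L (Pi.single c 1) c' := by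
  have hv : v = ∑ c, v c • (Pi.single c (1 : ℝ) : ι → ℝ) := by
    conv_lhs => rw [← Finset.univ_sum_single v]
    exact Finset.sum_congr rfl fun c _ => by rw [← Pi.single_smul', smul_eq_mul, mul_one]
  conv_lhs => rw [hv]
  rw [map_sum, Finset.sum_apply]
  exact Finset.sum_congr rfl fun c _ => by rw [map_smul, Pi.smul_apply, smul_eq_mul]

/-- **ROW-WISE MEAN-VALUE MATRIX.** `f` differentiable within the convex set `S` with derivative columns enclosed
entrywise by `[Mlo, Mhi]` on `S`; then for `z, z' ∈ S` there is a real matrix `A`, `Mlo ≤ A ≤ Mhi` entrywise, with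
`(f z − f z') c' = Σ_c A c' c · (z − z') c` for every row `c'`. [folklore] -/
theorem exists_matrix_mem_Icc_of_hasFDerivWithin {S : Set (ι → ℝ)} (hS : Convex ℝ S)
    {f : (ι → ℝ) → (ι → ℝ)} {f' : (ι → ℝ) → (ι → ℝ) →L[ℝ] (ι → ℝ)}
    (hf : ∀ x ∈ S, HasFDerivWithinAt f (f' x) S x) {Mlo Mhi : ι → ι → ℝ}
    (hM : ∀ x ∈ S, ∀ c c', Mlo c' c ≤ f' x (Pi.single c 1) c' ∧ f' x (Pi.single c 1) c' ≤ Mhi c' c)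
    {z z' : ι → ℝ} (hz : z ∈ S) (hz' : z' ∈ S) :
    ∃ A : ι → ι → ℝ, (∀ c' c, Mlo c' c ≤ A c' c ∧ A c' c ≤ Mhi c' c) ∧
      ∀ c', (f z - f z') c' = ∑ c, A c' c * (z - z') c := by
  -- the segment and its derivative
  have hseg : ∀ σ ∈ Icc (0:ℝ) 1, z' + σ • (z - z') ∈ S := by
    intro σ hσ
    have e : z' + σ • (z - z') = (1 - σ) • z' + σ • z := by
      rw [smul_sub, sub_smul, one_smul]; abel
    rw [e]
    exact hS hz' hz (by linarith [hσ.2]) hσ.1 (by ring)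
  -- per row: a mean-value point
  have hrow : ∀ c', ∃ ξ ∈ Ioo (0:ℝ) 1,
      (f z - f z') c' = ∑ c, f' (z' + ξ • (z - z')) (Pi.single c 1) c' * (z - z') c := by
    intro c'
    set g : ℝ → ℝ := fun σ => f (z' + σ • (z - z')) c' with hg
    have hline : ∀ σ, HasDerivAt (fun σ : ℝ => z' + σ • (z - z')) (z - z') σ := by
      intro σ
      have h1 := ((hasDerivAt_id σ).smul_const (z - z')).const_add z'
      simpa using h1
    have hgder : ∀ σ ∈ Icc (0:ℝ) 1, HasDerivWithinAt g (f' (z' + σ • (z - z')) (z - z') c') (Icc 0 1) σ := by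
      intro σ hσ
      have h1 : HasFDerivWithinAt f (f' (z' + σ • (z - z'))) S (z' + σ • (z - z')) := hf _ (hseg σ hσ)
      have h2 : HasDerivWithinAt (fun σ : ℝ => z' + σ • (z - z')) (z - z') (Icc 0 1) σ :=
        (hline σ).hasDerivWithinAt
      have h3 := h1.comp_hasDerivWithinAt σ h2 (fun τ hτ => hseg τ hτ)
      exact (hasDerivWithinAt_pi.1 h3) c'
    have hgc : ContinuousOn g (Icc 0 1) := fun σ hσ => (hgder σ hσ).continuousWithinAt
    have hgd : ∀ σ ∈ Ioo (0:ℝ) 1, HasDerivAt g (f' (z' + σ • (z - z')) (z - z') c') σ := fun σ hσ =>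
      (hgder σ (Ioo_subset_Icc_self hσ)).hasDerivAt (Icc_mem_nhds hσ.1 hσ.2)
    obtain ⟨ξ, hξ, hslope⟩ := exists_hasDerivAt_eq_slope g (fun σ => f' (z' + σ • (z - z')) (z - z') c')
      zero_lt_one hgc hgd
    refine ⟨ξ, hξ, ?_⟩
    have e1 : g 1 = f z c' := by simp [hg]
    have e0 : g 0 = f z' c' := by simp [hg]
    rw [e1, e0, sub_zero, div_one] at hslope
    rw [Pi.sub_apply, ← hslope, clm_apply_eq_sum_single]
    exact Finset.sum_congr rfl fun c _ => by ring
  choose ξ hξ hξeq using hrow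
  refine ⟨fun c' c => f' (z' + ξ c' • (z - z')) (Pi.single c 1) c', fun c' c => ?_, fun c' => hξeq c'⟩
  exact hM _ (hseg (ξ c') (Ioo_subset_Icc_self (hξ c'))) c c'


/-- **ROW-WISE MEAN-VALUE POINTS** (the point form of `exists_matrix_mem_Icc_of_hasFDerivWithin`): `f`
differentiable within the convex set `S`; for `z, z' ∈ S` every ROW of `f z − f z'` is the corresponding row of the
derivative at SOME point of the segment `[z', z]` applied to `z − z'`:
`(f z − f z') c' = Σ_c f' (ξ c') e_c c' · (z − z') c` with `ξ c' ∈ S` on the segment. [folklore] -/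
theorem exists_rowPoints_of_hasFDerivWithin {S : Set (ι → ℝ)} (hS : Convex ℝ S)
    {f : (ι → ℝ) → (ι → ℝ)} {f' : (ι → ℝ) → (ι → ℝ) →L[ℝ] (ι → ℝ)}
    (hf : ∀ x ∈ S, HasFDerivWithinAt f (f' x) S x) {z z' : ι → ℝ} (hz : z ∈ S) (hz' : z' ∈ S) :
    ∃ ξ : ι → (ι → ℝ), (∀ c', ξ c' ∈ S ∧ ∃ σ ∈ Icc (0:ℝ) 1, ξ c' = z' + σ • (z - z')) ∧
      ∀ c', (f z - f z') c' = ∑ c, f' (ξ c') (Pi.single c 1) c' * (z - z') c := by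
  have hseg : ∀ σ ∈ Icc (0:ℝ) 1, z' + σ • (z - z') ∈ S := by
    intro σ hσ
    have e : z' + σ • (z - z') = (1 - σ) • z' + σ • z := by
      rw [smul_sub, sub_smul, one_smul]; abel
    rw [e]
    exact hS hz' hz (by linarith [hσ.2]) hσ.1 (by ring)
  have hrow : ∀ c', ∃ σ ∈ Ioo (0:ℝ) 1,
      (f z - f z') c' = ∑ c, f' (z' + σ • (z - z')) (Pi.single c 1) c' * (z - z') c := by
    intro c'
    set g : ℝ → ℝ := fun σ => f (z' + σ • (z - z')) c' with hg
    have hline : ∀ σ, HasDerivAt (fun σ : ℝ => z' + σ • (z - z')) (z - z') σ := by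
      intro σ
      have h1 := ((hasDerivAt_id σ).smul_const (z - z')).const_add z'
      simpa using h1
    have hgder : ∀ σ ∈ Icc (0:ℝ) 1, HasDerivWithinAt g (f' (z' + σ • (z - z')) (z - z') c') (Icc 0 1) σ := by
      intro σ hσ
      have h1 : HasFDerivWithinAt f (f' (z' + σ • (z - z'))) S (z' + σ • (z - z')) := hf _ (hseg σ hσ)
      have h2 : HasDerivWithinAt (fun σ : ℝ => z' + σ • (z - z')) (z - z') (Icc 0 1) σ :=
        (hline σ).hasDerivWithinAt
      have h3 := h1.comp_hasDerivWithinAt σ h2 (fun τ hτ => hseg τ hτ)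
      exact (hasDerivWithinAt_pi.1 h3) c'
    have hgc : ContinuousOn g (Icc 0 1) := fun σ hσ => (hgder σ hσ).continuousWithinAt
    have hgd : ∀ σ ∈ Ioo (0:ℝ) 1, HasDerivAt g (f' (z' + σ • (z - z')) (z - z') c') σ := fun σ hσ =>
      (hgder σ (Ioo_subset_Icc_self hσ)).hasDerivAt (Icc_mem_nhds hσ.1 hσ.2)
    obtain ⟨σ, hσ, hslope⟩ := exists_hasDerivAt_eq_slope g (fun σ => f' (z' + σ • (z - z')) (z - z') c')
      zero_lt_one hgc hgd
    refine ⟨σ, hσ, ?_⟩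
    have e1 : g 1 = f z c' := by simp [hg]
    have e0 : g 0 = f z' c' := by simp [hg]
    rw [e1, e0, sub_zero, div_one] at hslope
    rw [Pi.sub_apply, ← hslope, clm_apply_eq_sum_single]
    exact Finset.sum_congr rfl fun c _ => by ring
  choose σ hσ hσeq using hrow
  refine ⟨fun c' => z' + σ c' • (z - z'), fun c' => ⟨hseg _ (Ioo_subset_Icc_self (hσ c')),
    σ c', Ioo_subset_Icc_self (hσ c'), rfl⟩, fun c' => hσeq c'⟩

end Summit.NavierStokesRegularity.NavierStokesRegularity.Theorems.TaylorModelVector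

end
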